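import Summits.Parity.BatemanHorn.Theorems.SoloInformedTwinBoxes

/-!
# The unbalanced twin sum, regime (1b) — III: classifying and counting boxes

Soloist file (informed mode), file F4c-α of the kernel project for (F′).  For the product boxes
of `SoloInformedTwinBoxes` (`M = boxLow_i` below `K`, `N = boxLow_l` below `hi`, cut
`c_q = ⌊y/q⌋`) we prove: further vanishing (`boxHigh_i ≤ K₀`; `boxHigh_l < 1`; even moduli for
the odd family), the two counting facts (for each `q` at most ONE `l` is cut by `c_q`; for each `l`
at most TWO `i` straddle the hyperbola `ke = hi` at ratio `(1+Δ)²`), the two geometric sums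
(`∑_{M_i ≤ c} M_i ≤ (1+Δ)c/Δ`, `∑_{N_l > c} 1/N_l ≤ (1+Δ)/(Δc)`, by telescoping), the number of
boxes (`T < (1+Δ)^{⌊2 log T/Δ⌋+1}`), and the POINTWISE CLASSIFICATION of `|boxSum(q; i, l)|` into
the four classes T (small product `MN < V`), P (cut box), H (hyperbola box), F (free box), the
first three carrying the trivial bound `abs_boxSum_le` and the last `|freeSum(q; i, l)|`.
-/

namespace Summit.Parity.BatemanHorn.Theorems

open Finset Real
open scoped ArithmeticFunction.Moebius
open Literature.NumberTheory.Sieve Literature.NumberTheory.Sieve.BFI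

/-! ### 1. More vanishing -/

/-- A box of cofactors entirely below `K₀` carries no `k ∈ (K₀, K]`: `boxSum = 0`. -/
theorem boxSum_eq_zero_of_boxHigh_le {Δ : ℝ} {K hi y q i l K₀ : ℕ}
    (h : boxHigh (K : ℝ) Δ i ≤ K₀) (j r₀ : ℕ) (a : ℤ) :
    boxSum j r₀ hi y a K₀ K Δ q i l = 0 := by
  unfold boxSum
  refine Finset.sum_eq_zero fun k hk => ?_
  exfalso
  obtain ⟨hk', ⟨-, -, hkhi⟩, -⟩ := Finset.mem_filter.1 hk
  have : (K₀ : ℝ) < k := by exact_mod_cast (Finset.mem_Ioc.1 hk').1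
  linarith

/-- A box of variables with `boxHigh_l < 1` contains no integer `e ≥ 1`: `boxSum = 0`. -/
theorem boxSum_eq_zero_of_boxHigh_lt_one {Δ : ℝ} {K hi y q i l K₀ : ℕ}
    (h : boxHigh (hi : ℝ) Δ l < 1) (j r₀ : ℕ) (a : ℤ) :
    boxSum j r₀ hi y a K₀ K Δ q i l = 0 := by
  unfold boxSum
  refine Finset.sum_eq_zero fun k _ => Finset.sum_eq_zero fun e he => ?_
  exfalso
  obtain ⟨-, ⟨he0, -, hehi⟩⟩ := Finset.mem_filter.1 he
  have : (1 : ℝ) ≤ e := by exact_mod_cast he0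
  linarith

/-- The parity obstruction of the odd family: `q` even, `a` even, `k` and `e` odd contradict
`ke ≡ a (q)`. -/
theorem switch_class_false_of_even {q k e : ℕ} {a : ℤ} (hq : 2 ∣ q) (ha2 : (2 : ℤ) ∣ a)
    (hk : k.Coprime 2) (he : e.Coprime 2) (hcl : ((k * e : ℕ) : ZMod q) = (a : ZMod q)) :
    False := by
  have hcop : (k * e).Coprime 2 := Nat.Coprime.mul_left hk he
  rw [natCast_zmod_eq_intCast_iff] at hcl
  have h1 : (2 : ℤ) ∣ a - (k * e : ℕ) := (Int.natCast_dvd_natCast.mpr hq).trans hcl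
  have h' := dvd_sub ha2 h1
  rw [sub_sub_cancel] at h'
  have h3 : 2 ∣ k * e := Int.natCast_dvd_natCast.mp h'
  have h4 : Nat.gcd (k * e) 2 = 1 := hcop
  have : (2 : ℕ) ∣ 1 := h4 ▸ Nat.dvd_gcd h3 (dvd_refl 2)
  omega

/-- The odd family (`r₀ = 2`, `2 ∣ a`) vanishes at even moduli: `boxSum = 0`. -/
theorem boxSum_eq_zero_of_even {Δ : ℝ} {K hi y q i l K₀ : ℕ} {a : ℤ} (hq : 2 ∣ q)
    (ha2 : (2 : ℤ) ∣ a) (j : ℕ) : boxSum j 2 hi y a K₀ K Δ q i l = 0 := by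
  unfold boxSum
  refine Finset.sum_eq_zero fun k hk => Finset.sum_eq_zero fun e _ => ?_
  obtain ⟨-, -, hk2⟩ := Finset.mem_filter.1 hk
  split_ifs with hcl
  · unfold moebiusLogPiece
    split_ifs with hcond
    · exact (switch_class_false_of_even hq ha2 hk2 hcond.2.2 hcl).elim
    · rfl
  · rfl

/-- The odd family (`r₀ = 2`, `2 ∣ a`) vanishes at even moduli: `freeSum = 0`. -/
theorem freeSum_eq_zero_of_even {Δ : ℝ} {K hi q i l K₀ : ℕ} {a : ℤ} (hq : 2 ∣ q)
    (ha2 : (2 : ℤ) ∣ a) (j : ℕ) : freeSum j 2 hi a K₀ K Δ q i l = 0 := by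
  unfold freeSum
  refine Finset.sum_eq_zero fun k hk => Finset.sum_eq_zero fun e _ => ?_
  obtain ⟨-, -, hk2⟩ := Finset.mem_filter.1 hk
  split_ifs with hcl
  · unfold moebiusLogPiece
    split_ifs with hcond
    · exact (switch_class_false_of_even hq ha2 hk2 hcond.2.2 hcl).elim
    · rfl
  · rfl

/-- On the family (`r₀ = 1`, or `r₀ = 2` with `2 ∣ a`) the sum of `|freeSum|` over all moduli
`q ≤ z` equals the sum over the moduli prime to `r₀`. -/
theorem sum_abs_freeSum_eq_sum_filter {Δ : ℝ} {K hi i l K₀ : ℕ} {r₀ : ℕ} {a : ℤ}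
    (hfam : r₀ = 1 ∨ (r₀ = 2 ∧ (2 : ℤ) ∣ a)) (j z : ℕ) :
    ∑ q ∈ Icc 1 z, |freeSum j r₀ hi a K₀ K Δ q i l| =
      ∑ q ∈ (Icc 1 z).filter (fun q : ℕ => q.Coprime r₀), |freeSum j r₀ hi a K₀ K Δ q i l| := by
  rw [Finset.sum_filter]
  refine Finset.sum_congr rfl fun q _ => ?_
  split_ifs with h
  · rfl
  · rcases hfam with rfl | ⟨rfl, ha2⟩
    · exact absurd (Nat.coprime_one_right q) h
    · have hq : 2 ∣ q := by
        rcases Nat.Prime.eq_one_or_self_of_dvd Nat.prime_two (Nat.gcd q 2) (Nat.gcd_dvd_right q 2)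
          with h1 | h2
        · exact absurd h1 h
        · exact h2 ▸ Nat.gcd_dvd_left q 2
      rw [freeSum_eq_zero_of_even hq ha2, abs_zero]

/-! ### 2. Counting boxes -/

/-- **At most one cut box**: a real `c` lies strictly inside at most one box `(boxLow_l, boxHigh_l)`. -/
theorem card_filter_cut_le_one {T Δ : ℝ} (hT : 0 < T) (hΔ : 0 ≤ Δ) (c : ℝ) (s : Finset ℕ) :
    #(s.filter (fun l => boxLow T Δ l < c ∧ c < boxHigh T Δ l)) ≤ 1 := by
  rw [Finset.card_le_one]
  intro l hl l' hl'
  obtain ⟨-, h1, h2⟩ := Finset.mem_filter.1 hl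
  obtain ⟨-, h1', h2'⟩ := Finset.mem_filter.1 hl'
  by_contra hne
  have key : ∀ {m m' : ℕ}, m < m' → boxHigh T Δ m' ≤ boxLow T Δ m := by
    intro m m' hmm'
    unfold boxHigh boxLow
    exact div_le_div_of_nonneg_left hT.le (by positivity) (pow_le_pow_right₀ (by linarith) (by omega))
  rcases lt_or_gt_of_ne hne with h | h
  · linarith [key h]
  · linarith [key h]

/-- `(1+Δ)² · boxLow (m+2) = boxLow m`. -/
theorem boxLow_eq_sq_mul_boxLow_add_two {T Δ : ℝ} (hΔ : -1 < Δ) (m : ℕ) :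
    boxLow T Δ m = (1 + Δ) ^ 2 * boxLow T Δ (m + 2) := by
  rw [← boxHigh_succ m, boxHigh_eq_mul_boxLow hΔ (m + 1), ← boxHigh_succ (m + 1),
    boxHigh_eq_mul_boxLow hΔ (m + 2)]
  ring

/-- **At most two hyperbola boxes**: the `i` with `boxLow_i ≤ c < (1+Δ)² boxLow_i` are at most
two (consecutive boxes have ratio `1+Δ`). -/
theorem card_filter_hyper_le_two {T Δ : ℝ} (hT : 0 < T) (hΔ : 0 ≤ Δ) (c : ℝ) (s : Finset ℕ) :
    #(s.filter (fun i => boxLow T Δ i ≤ c ∧ c < (1 + Δ) ^ 2 * boxLow T Δ i)) ≤ 2 := by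
  set F := s.filter (fun i => boxLow T Δ i ≤ c ∧ c < (1 + Δ) ^ 2 * boxLow T Δ i) with hF
  rcases F.eq_empty_or_nonempty with h0 | hne
  · rw [h0]; simp
  · have hsub : F ⊆ {F.min' hne, F.min' hne + 1} := by
      intro i hi
      have hmin := F.min'_le i hi
      rw [Finset.mem_insert, Finset.mem_singleton]
      by_contra hc
      have h2 : F.min' hne + 2 ≤ i := by omega
      obtain ⟨-, hA, -⟩ := Finset.mem_filter.1 (F.min'_mem hne)
      obtain ⟨-, -, hB⟩ := Finset.mem_filter.1 hi
      obtain ⟨m, hm⟩ : ∃ m, i = m + 2 := ⟨i - 2, by omega⟩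
      rw [hm] at hB
      have h3 : boxLow T Δ m ≤ boxLow T Δ (F.min' hne) := boxLow_anti hT hΔ (by omega)
      rw [boxLow_eq_sq_mul_boxLow_add_two (by linarith) m] at h3
      linarith
    calc #F ≤ #({F.min' hne, F.min' hne + 1} : Finset ℕ) := Finset.card_le_card hsub
      _ ≤ 2 := Finset.card_le_two

/-- **Geometric sum of the box floors**: `∑_{i<I, boxLow_i ≤ c} boxLow_i ≤ (1+Δ) c/Δ`
(`T, c ≥ 0`, `Δ > 0`; telescoping `boxLow_i = (boxHigh_i − boxLow_i)/Δ`). -/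
theorem sum_boxLow_indicator_le {T Δ : ℝ} (hT : 0 ≤ T) (hΔ : 0 < Δ) {c : ℝ} (hc : 0 ≤ c)
    (I : ℕ) : ∑ i ∈ Finset.range I, (if boxLow T Δ i ≤ c then boxLow T Δ i else 0) ≤
      (1 + Δ) * c / Δ := by
  set g : ℕ → ℝ := fun i => min (boxHigh T Δ i) ((1 + Δ) * c) with hg
  have hgsucc : ∀ i, g (i + 1) = min (boxLow T Δ i) ((1 + Δ) * c) := fun i => by
    simp only [hg, boxHigh_succ]
  have hterm : ∀ i, (if boxLow T Δ i ≤ c then boxLow T Δ i else 0) ≤ (g i - g (i + 1)) / Δ := by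
    intro i
    rw [hgsucc]
    have hHL : boxHigh T Δ i = (1 + Δ) * boxLow T Δ i := boxHigh_eq_mul_boxLow (by linarith) i
    have hL0 : 0 ≤ boxLow T Δ i := by unfold boxLow; positivity
    split_ifs with h
    · have e1 : min (boxHigh T Δ i) ((1 + Δ) * c) = boxHigh T Δ i :=
        min_eq_left (by rw [hHL]; nlinarith)
      have e2 : min (boxLow T Δ i) ((1 + Δ) * c) = boxLow T Δ i := min_eq_left (by nlinarith)
      simp only [hg]
      rw [e1, e2, hHL, le_div_iff₀ hΔ]
      nlinarith
    · refine div_nonneg (sub_nonneg.2 ?_) hΔ.le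
      exact min_le_min_right _ (by rw [hHL]; nlinarith)
  calc ∑ i ∈ Finset.range I, (if boxLow T Δ i ≤ c then boxLow T Δ i else 0)
      ≤ ∑ i ∈ Finset.range I, (g i - g (i + 1)) / Δ := Finset.sum_le_sum fun i _ => hterm i
    _ = (g 0 - g I) / Δ := by rw [← Finset.sum_div, Finset.sum_range_sub']
    _ ≤ g 0 / Δ := by
        refine div_le_div_of_nonneg_right ?_ hΔ.le
        have : 0 ≤ g I := by
          simp only [hg]
          refine le_min ?_ (by positivity)
          unfold boxHigh; positivity
        linarith
    _ ≤ (1 + Δ) * c / Δ := div_le_div_of_nonneg_right (min_le_right _ _) hΔ.le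

/-- **Geometric sum of the reciprocals**: `∑_{l<I, boxLow_l > c} 1/boxLow_l ≤ (1+Δ)/(Δ c)`
(`T, c > 0`, `Δ > 0`; telescoping `1/boxLow_l − 1/boxHigh_l = Δ/boxHigh_l`). -/
theorem sum_inv_boxLow_indicator_le {T Δ : ℝ} (hT : 0 < T) (hΔ : 0 < Δ) {c : ℝ} (hc : 0 < c)
    (I : ℕ) : ∑ l ∈ Finset.range I, (if c < boxLow T Δ l then 1 / boxLow T Δ l else 0) ≤
      (1 + Δ) / (Δ * c) := by
  set u : ℕ → ℝ := fun l => 1 / max (boxHigh T Δ l) c with hu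
  have husucc : ∀ l, u (l + 1) = 1 / max (boxLow T Δ l) c := fun l => by
    simp only [hu, boxHigh_succ]
  have hterm : ∀ l, (if c < boxLow T Δ l then 1 / boxLow T Δ l else 0) ≤
      (1 + Δ) / Δ * (u (l + 1) - u l) := by
    intro l
    rw [husucc]
    have hHL : boxHigh T Δ l = (1 + Δ) * boxLow T Δ l := boxHigh_eq_mul_boxLow (by linarith) l
    have hLpos : 0 < boxLow T Δ l := boxLow_pos hT (by linarith) l
    split_ifs with h
    · have e1 : max (boxLow T Δ l) c = boxLow T Δ l := max_eq_left h.le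
      have e2 : max (boxHigh T Δ l) c = boxHigh T Δ l := max_eq_left (by rw [hHL]; nlinarith)
      simp only [hu]
      rw [e1, e2, hHL]
      rw [show (1 + Δ) / Δ * (1 / boxLow T Δ l - 1 / ((1 + Δ) * boxLow T Δ l)) =
        1 / boxLow T Δ l by field_simp; ring]
    · refine mul_nonneg (by positivity) (sub_nonneg.2 ?_)
      simp only [hu]
      refine one_div_le_one_div_of_le (lt_max_of_lt_right hc) ?_
      exact max_le_max_right _ (by rw [hHL]; nlinarith)
  calc ∑ l ∈ Finset.range I, (if c < boxLow T Δ l then 1 / boxLow T Δ l else 0)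
      ≤ ∑ l ∈ Finset.range I, (1 + Δ) / Δ * (u (l + 1) - u l) := Finset.sum_le_sum fun l _ => hterm l
    _ = (1 + Δ) / Δ * (u I - u 0) := by rw [← Finset.mul_sum, Finset.sum_range_sub]
    _ ≤ (1 + Δ) / Δ * (1 / c) := by
        refine mul_le_mul_of_nonneg_left ?_ (by positivity)
        have h1 : u I ≤ 1 / c := one_div_le_one_div_of_le hc (le_max_right _ _)
        have h2 : 0 ≤ u 0 := by simp only [hu]; positivity
        linarith
    _ = (1 + Δ) / (Δ * c) := by rw [div_mul_div_comm, mul_one]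

/-- **Number of boxes**: for `0 < Δ ≤ 1` and `T > 0`, `T < (1+Δ)^{⌊2 log T/Δ⌋ + 1}`
(`log(1+Δ) ≥ Δ/(1+Δ) ≥ Δ/2`). -/
theorem lt_one_add_pow_boxCount {Δ T : ℝ} (hΔ : 0 < Δ) (hΔ1 : Δ ≤ 1) (hT : 0 < T) :
    T < (1 + Δ) ^ (⌊2 * Real.log T / Δ⌋₊ + 1) := by
  set n : ℕ := ⌊2 * Real.log T / Δ⌋₊ + 1 with hn
  have h1 : 0 < 1 + Δ := by linarith
  rw [← Real.log_lt_log_iff hT (pow_pos h1 n), Real.log_pow]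
  have hlog : Δ / 2 ≤ Real.log (1 + Δ) := by
    have := Real.one_sub_inv_le_log_of_pos h1
    have e : 1 - (1 + Δ)⁻¹ = Δ / (1 + Δ) := by field_simp; ring
    rw [e] at this
    refine le_trans ?_ this
    rw [div_le_div_iff₀ (by norm_num) h1]
    nlinarith
  have hnlt : 2 * Real.log T / Δ < n := by rw [hn]; push_cast; exact Nat.lt_floor_add_one _
  have h2 : Real.log T < n * (Δ / 2) := by
    rw [div_lt_iff₀ hΔ] at hnlt; linarith
  exact h2.trans_le (mul_le_mul_of_nonneg_left hlog (by positivity))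

/-! ### 3. The pointwise classification -/

/-- The trivial box bound of `abs_boxSum_le`: `(log hi)^j (boxHigh_i − boxLow_i + 1)
((boxHigh_l − boxLow_l)/q + 1)`. -/
noncomputable def boxTriv (j hi K : ℕ) (Δ : ℝ) (q i l : ℕ) : ℝ :=
  Real.log hi ^ j * (boxHigh (K : ℝ) Δ i - boxLow (K : ℝ) Δ i + 1) *
    ((boxHigh (hi : ℝ) Δ l - boxLow (hi : ℝ) Δ l) / q + 1)

/-- `boxTriv ≥ 0` (`Δ ≥ 0`). -/
theorem boxTriv_nonneg {Δ : ℝ} (hΔ : 0 ≤ Δ) (j hi K q i l : ℕ) : 0 ≤ boxTriv j hi K Δ q i l := by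
  unfold boxTriv
  have h1 := sub_nonneg.2 (boxLow_le_boxHigh (Nat.cast_nonneg K) hΔ i)
  have h2 := sub_nonneg.2 (boxLow_le_boxHigh (Nat.cast_nonneg hi) hΔ l)
  have h3 : 0 ≤ Real.log hi := Real.log_natCast_nonneg hi
  positivity

/-- **Pointwise classification of a box sum.**  For a reduced class (`q ≥ 1`, `(q,a) = 1`),
`0 < Δ`, any threshold `V`, with `M = boxLow_i`, `N = boxLow_l`, `c_q = ⌊y/q⌋`:
`|boxSum(q;i,l)| ≤ 𝟙_T·triv + 𝟙_P·triv + 𝟙_H·triv + 𝟙_F·|freeSum(q;i,l)|`, where all classes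
require `K₀ < boxHigh_i`, and T: `1 ≤ boxHigh_l`, `c_q < boxHigh_l`, `MN ≤ hi`, `MN < V`;
P: the same with `N < c_q` in place of `MN < V`; H: `c_q ≤ N`, `MN ≤ hi < (1+Δ)²MN`;
F: `c_q ≤ N`, `(1+Δ)²MN ≤ hi`, `V ≤ MN` (there `boxSum = freeSum`); otherwise `boxSum = 0`. -/
theorem abs_boxSum_le_classes {Δ : ℝ} (hΔ : 0 < Δ) {q : ℕ} (hq : 0 < q) {a : ℤ}
    (ha : IsCoprime (q : ℤ) a) (j r₀ hi y K₀ K i l : ℕ) (V : ℝ) :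
    |boxSum j r₀ hi y a K₀ K Δ q i l| ≤
      (if (K₀ : ℝ) < boxHigh (K : ℝ) Δ i ∧ 1 ≤ boxHigh (hi : ℝ) Δ l ∧
          ((y / q : ℕ) : ℝ) < boxHigh (hi : ℝ) Δ l ∧ boxLow (K : ℝ) Δ i * boxLow (hi : ℝ) Δ l ≤ hi ∧
          boxLow (K : ℝ) Δ i * boxLow (hi : ℝ) Δ l < V then boxTriv j hi K Δ q i l else 0) +
      (if (K₀ : ℝ) < boxHigh (K : ℝ) Δ i ∧ 1 ≤ boxHigh (hi : ℝ) Δ l ∧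
          ((y / q : ℕ) : ℝ) < boxHigh (hi : ℝ) Δ l ∧ boxLow (K : ℝ) Δ i * boxLow (hi : ℝ) Δ l ≤ hi ∧
          boxLow (hi : ℝ) Δ l < ((y / q : ℕ) : ℝ) then boxTriv j hi K Δ q i l else 0) +
      (if (K₀ : ℝ) < boxHigh (K : ℝ) Δ i ∧ ((y / q : ℕ) : ℝ) ≤ boxLow (hi : ℝ) Δ l ∧
          boxLow (K : ℝ) Δ i * boxLow (hi : ℝ) Δ l ≤ hi ∧
          (hi : ℝ) < (1 + Δ) ^ 2 * (boxLow (K : ℝ) Δ i * boxLow (hi : ℝ) Δ l)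
        then boxTriv j hi K Δ q i l else 0) +
      (if (K₀ : ℝ) < boxHigh (K : ℝ) Δ i ∧ ((y / q : ℕ) : ℝ) ≤ boxLow (hi : ℝ) Δ l ∧
          (1 + Δ) ^ 2 * (boxLow (K : ℝ) Δ i * boxLow (hi : ℝ) Δ l) ≤ hi ∧
          V ≤ boxLow (K : ℝ) Δ i * boxLow (hi : ℝ) Δ l
        then |freeSum j r₀ hi a K₀ K Δ q i l| else 0) := by
  have ht0 : 0 ≤ boxTriv j hi K Δ q i l := boxTriv_nonneg hΔ.le j hi K q i l
  have hbound : |boxSum j r₀ hi y a K₀ K Δ q i l| ≤ boxTriv j hi K Δ q i l :=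
    abs_boxSum_le hΔ.le hq ha j r₀ hi y K₀ K i l
  -- the four terms are nonnegative
  have n1 : ∀ (p : Prop) [Decidable p], 0 ≤ (if p then boxTriv j hi K Δ q i l else 0) :=
    fun p _ => by split_ifs <;> [exact ht0; exact le_rfl]
  have n4 : ∀ (p : Prop) [Decidable p], 0 ≤ (if p then |freeSum j r₀ hi a K₀ K Δ q i l| else 0) :=
    fun p _ => by split_ifs <;> [exact abs_nonneg _; exact le_rfl]
  set M := boxLow (K : ℝ) Δ i with hM
  set N := boxLow (hi : ℝ) Δ l with hN
  set c : ℝ := ((y / q : ℕ) : ℝ) with hc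
  have hHi : boxHigh (K : ℝ) Δ i = (1 + Δ) * M := boxHigh_eq_mul_boxLow (by linarith) i
  have hHl : boxHigh (hi : ℝ) Δ l = (1 + Δ) * N := boxHigh_eq_mul_boxLow (by linarith) l
  by_cases hNV : (K₀ : ℝ) < boxHigh (K : ℝ) Δ i ∧ 1 ≤ boxHigh (hi : ℝ) Δ l ∧
      c < boxHigh (hi : ℝ) Δ l ∧ M * N ≤ hi
  · obtain ⟨h1, h2, h3, h4⟩ := hNV
    by_cases hV : M * N < V
    · have e : (if (K₀ : ℝ) < boxHigh (K : ℝ) Δ i ∧ 1 ≤ boxHigh (hi : ℝ) Δ l ∧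
          c < boxHigh (hi : ℝ) Δ l ∧ M * N ≤ hi ∧ M * N < V then boxTriv j hi K Δ q i l else 0) =
          boxTriv j hi K Δ q i l := if_pos ⟨h1, h2, h3, h4, hV⟩
      linarith [n1 ((K₀ : ℝ) < boxHigh (K : ℝ) Δ i ∧ 1 ≤ boxHigh (hi : ℝ) Δ l ∧
          c < boxHigh (hi : ℝ) Δ l ∧ M * N ≤ hi ∧ N < c),
        n1 ((K₀ : ℝ) < boxHigh (K : ℝ) Δ i ∧ c ≤ N ∧ M * N ≤ hi ∧ (hi : ℝ) < (1 + Δ) ^ 2 * (M * N)),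
        n4 ((K₀ : ℝ) < boxHigh (K : ℝ) Δ i ∧ c ≤ N ∧ (1 + Δ) ^ 2 * (M * N) ≤ hi ∧ V ≤ M * N)]
    · rw [not_lt] at hV
      by_cases hP : N < c
      · have e : (if (K₀ : ℝ) < boxHigh (K : ℝ) Δ i ∧ 1 ≤ boxHigh (hi : ℝ) Δ l ∧
            c < boxHigh (hi : ℝ) Δ l ∧ M * N ≤ hi ∧ N < c then boxTriv j hi K Δ q i l else 0) =
            boxTriv j hi K Δ q i l := if_pos ⟨h1, h2, h3, h4, hP⟩
        linarith [n1 ((K₀ : ℝ) < boxHigh (K : ℝ) Δ i ∧ 1 ≤ boxHigh (hi : ℝ) Δ l ∧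
            c < boxHigh (hi : ℝ) Δ l ∧ M * N ≤ hi ∧ M * N < V),
          n1 ((K₀ : ℝ) < boxHigh (K : ℝ) Δ i ∧ c ≤ N ∧ M * N ≤ hi ∧ (hi : ℝ) < (1 + Δ) ^ 2 * (M * N)),
          n4 ((K₀ : ℝ) < boxHigh (K : ℝ) Δ i ∧ c ≤ N ∧ (1 + Δ) ^ 2 * (M * N) ≤ hi ∧ V ≤ M * N)]
      · rw [not_lt] at hP
        by_cases hH : (hi : ℝ) < (1 + Δ) ^ 2 * (M * N)
        · have e : (if (K₀ : ℝ) < boxHigh (K : ℝ) Δ i ∧ c ≤ N ∧ M * N ≤ hi ∧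
              (hi : ℝ) < (1 + Δ) ^ 2 * (M * N) then boxTriv j hi K Δ q i l else 0) =
              boxTriv j hi K Δ q i l := if_pos ⟨h1, hP, h4, hH⟩
          linarith [n1 ((K₀ : ℝ) < boxHigh (K : ℝ) Δ i ∧ 1 ≤ boxHigh (hi : ℝ) Δ l ∧
              c < boxHigh (hi : ℝ) Δ l ∧ M * N ≤ hi ∧ M * N < V),
            n1 ((K₀ : ℝ) < boxHigh (K : ℝ) Δ i ∧ 1 ≤ boxHigh (hi : ℝ) Δ l ∧
              c < boxHigh (hi : ℝ) Δ l ∧ M * N ≤ hi ∧ N < c),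
            n4 ((K₀ : ℝ) < boxHigh (K : ℝ) Δ i ∧ c ≤ N ∧ (1 + Δ) ^ 2 * (M * N) ≤ hi ∧ V ≤ M * N)]
        · rw [not_lt] at hH
          have hfree : boxSum j r₀ hi y a K₀ K Δ q i l = freeSum j r₀ hi a K₀ K Δ q i l := by
            refine boxSum_eq_freeSum ?_ hP j r₀ a K₀
            rw [hHi, hHl]
            calc (1 + Δ) * M * ((1 + Δ) * N) = (1 + Δ) ^ 2 * (M * N) := by ring
              _ ≤ hi := hH
          have e : (if (K₀ : ℝ) < boxHigh (K : ℝ) Δ i ∧ c ≤ N ∧ (1 + Δ) ^ 2 * (M * N) ≤ hi ∧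
              V ≤ M * N then |freeSum j r₀ hi a K₀ K Δ q i l| else 0) =
              |freeSum j r₀ hi a K₀ K Δ q i l| := if_pos ⟨h1, hP, hH, hV⟩
          rw [hfree]
          linarith [n1 ((K₀ : ℝ) < boxHigh (K : ℝ) Δ i ∧ 1 ≤ boxHigh (hi : ℝ) Δ l ∧
              c < boxHigh (hi : ℝ) Δ l ∧ M * N ≤ hi ∧ M * N < V),
            n1 ((K₀ : ℝ) < boxHigh (K : ℝ) Δ i ∧ 1 ≤ boxHigh (hi : ℝ) Δ l ∧
              c < boxHigh (hi : ℝ) Δ l ∧ M * N ≤ hi ∧ N < c),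
            n1 ((K₀ : ℝ) < boxHigh (K : ℝ) Δ i ∧ c ≤ N ∧ M * N ≤ hi ∧
              (hi : ℝ) < (1 + Δ) ^ 2 * (M * N))]
  · -- the box sum vanishes
    have hzero : boxSum j r₀ hi y a K₀ K Δ q i l = 0 := by
      by_cases g1 : boxHigh (K : ℝ) Δ i ≤ K₀
      · exact boxSum_eq_zero_of_boxHigh_le g1 j r₀ a
      by_cases g2 : boxHigh (hi : ℝ) Δ l < 1
      · exact boxSum_eq_zero_of_boxHigh_lt_one g2 j r₀ a
      by_cases g3 : boxHigh (hi : ℝ) Δ l ≤ c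
      · exact boxSum_eq_zero_of_le g3 j r₀ a K₀
      by_cases g4 : (hi : ℝ) < M * N
      · exact boxSum_eq_zero_of_lt hΔ.le g4 j r₀ a K₀
      exact absurd ⟨not_le.1 g1, not_lt.1 g2, not_le.1 g3, not_lt.1 g4⟩ hNV
    rw [hzero, abs_zero]
    linarith [n1 ((K₀ : ℝ) < boxHigh (K : ℝ) Δ i ∧ 1 ≤ boxHigh (hi : ℝ) Δ l ∧
        c < boxHigh (hi : ℝ) Δ l ∧ M * N ≤ hi ∧ M * N < V),
      n1 ((K₀ : ℝ) < boxHigh (K : ℝ) Δ i ∧ 1 ≤ boxHigh (hi : ℝ) Δ l ∧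
        c < boxHigh (hi : ℝ) Δ l ∧ M * N ≤ hi ∧ N < c),
      n1 ((K₀ : ℝ) < boxHigh (K : ℝ) Δ i ∧ c ≤ N ∧ M * N ≤ hi ∧ (hi : ℝ) < (1 + Δ) ^ 2 * (M * N)),
      n4 ((K₀ : ℝ) < boxHigh (K : ℝ) Δ i ∧ c ≤ N ∧ (1 + Δ) ^ 2 * (M * N) ≤ hi ∧ V ≤ M * N)]

end Summit.Parity.BatemanHorn.Theorems
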